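import Summits.CriticalPhenomena.PercolationContinuityZ3.Theorems.Transplant.SkelPhiFaceExitPieces
import Summits.CriticalPhenomena.PercolationContinuityZ3.Theorems.Transplant.SkelPhiEquilibriumW2S
import Summits.CriticalPhenomena.PercolationContinuityZ3.Theorems.Transplant.SkelPhiOrientation
import HarnessLib

/-!
# N2 (S3 line), kit tier: THE EXIT LEMMAS FOR THE SLID SIDE HALVES `pgSideHalfS` — S-twins of `SkelPhiFaceExitPieces` §3/§4
# (`exit_frame_raw_sideHalf` :221, `exit_frame_lv_zero_sideHalf` :293) + the transposed level-side twin replacing the top-piece lemma :251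

builds on p205010 (kernel theorem, internal audit signed; external expert review pending) — nothing in this file uses p205010; nothing is claimed about
any node (geometry only).  Lane `prim-bschramm`, seat `prim-bschramm-p1` (gen 15; kit tier of record per V126 / N2-PORT-PICTURE-S3 v1.1 items 3/7,
p5-g13's (C1)); helper file (`--supports stmt-CriticalPhenomena-4575 --as helper`).
READING: a vertex `v` of a slid side half `pgSideHalfS G φ s o n_s h_s L ℓ_s R σ τ m` (SkelPhiEquilibriumW2S :84; base `s`, frozen offset `o`,
independent split offset `|m| ≤ n_s`) is read at a base vertex `tc` with `φ tc = φ s + o` through W2S's bridge (`relCoordO_eq_of_base`,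
`shearCoordO_eq_of_base`): `σ·Δα(tc) = n_s` (raw displacement) and, on the favourable half `(σ₀e, −σ₀f)` with `e v_β = |v_β|`, `f v_α = |v_α|`,
`A·(|v_β| n_s − |v_α| (|h_s| + 1)) ≤ σ₀·A·(v_β Δα − v_α Δβ)` (the `+1` = one chart unit for the split offset `m`).  Hence, with the kit centre AT `tc`:
* `exit_frame_raw_sideHalfS` — raw side `(oth I, σ₀)`, x side half (`b = 0`): `L(φ v) + A′ + climC ≤ L(φ tc)` once `A′ + 2D ≤ n_s·D`;
* `exit_frame_raw_sideHalfST` — raw side, `b = 1`: the same for a side half of the TRANSPOSED record `trφ φ` (its side line is `Δβ = σ n_s`);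
* `exit_frame_lv_zero_sideHalfS` — level side `(0, σ₀)` of a v-face frame: favourable half, `(k+1)·D ≤ c₀·A·(|v_β| n_s − |v_α|(|h_s|+1))`;
* `exit_frame_lv_one_sideHalfT` — level side `(1, σ₀)` of a u-face frame (`0 ≤ n`): favourable side half OF THE TRANSPOSED RECORD with `f·h = |h|`,
  `(k+1)·D ≤ c₁·A·(n·n_s − |h|(|h_s|+1))` — replaces the y′ top-piece lemma of N1 (no slant, no shear term).
NOT here: which `tc`/`o` the kit clause uses (the kit-clause twin, GO-dependent), sizes of `n_s, ℓ_s` (stmt's ledger).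
[cite: MartineauTassion2017, §3.2 (L(a,u), L(u,b))] [cite: KozmaNitzan2024, §4 Lemma 10 Step IV (pp. 20–21)]
-/

noncomputable section

open scoped Classical

namespace Summit.CriticalPhenomena.PercolationContinuityZ3.Theorems.Transplant

namespace Skelφ

open Literature.Probability.Percolation Literature.Probability.LatticeModels SimpleGraph
open Literature.Probability.Percolation.KozmaNitzan.Cells (oth oth_ne eq_oth_of_ne oth_oth)
open TwoAxis.Para (coarse lam0 lam1 bp)

variable {V : Type} {G : SimpleGraph V} [G.LocallyFinite] {φ : V → Site 2}

/-! ## §1 Displacements of the slid side halves, read at a base vertex `tc` with `φ tc = φ s + o` -/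

/-- **Raw displacement of a slid side half**: `σ·Δα(tc) = n_s` on `pgSideHalfS s o n_s …` when `φ tc = φ s + o` (`σ = ±1`).
[cite: MartineauTassion2017, §3.2] -/
theorem disp_raw_sideHalfS {s tc : V} {o : Site 2} (htc : φ tc = φ s + o) {nS : ℕ} {hS : ℤ} {L ℓS R : ℕ} {σ τ m : ℤ}
    (hσ : σ = 1 ∨ σ = -1) {v : V} (hv : v ∈ pgSideHalfS G φ s o nS hS L ℓS R σ τ m) : σ * relCoord φ tc 0 v = nS := by
  obtain ⟨-, -, hα, -⟩ := (mem_pgSideHalfS G φ).1 hv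
  rw [relCoordO_eq_of_base htc] at hα
  rw [hα, ← mul_assoc]
  rcases hσ with rfl | rfl <;> simp

/-- **Level displacement of a favourable slid side half** (coefficients `(v_α, v_β)`, `0 < A`, sign bits `e v_β = |v_β|`, `f v_α = |v_α|`, split `|m| ≤ n_s`):
on `pgSideHalfS s o n_s h_s L ℓ_s R (σ₀e) (−σ₀f) m`, read at `tc` with `φ tc = φ s + o`,
`A·(|v_β| n_s − |v_α|(|h_s| + 1)) ≤ σ₀·A·(v_β Δα − v_α Δβ)`. [cite: MartineauTassion2017, §3.2] -/
theorem disp_lv_sideHalfS {s tc : V} {o : Site 2} (htc : φ tc = φ s + o) {nS : ℕ} (hnS : 1 ≤ nS) {hS : ℤ} {L ℓS R : ℕ}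
    {σ₀ e f m : ℤ} (hσ₀ : σ₀ = 1 ∨ σ₀ = -1) (he : e = 1 ∨ e = -1) (hf : f = 1 ∨ f = -1) (hm : |m| ≤ nS)
    {A vα vβ : ℤ} (hA : 0 < A) (hev : e * vβ = |vβ|) (hfv : f * vα = |vα|)
    {v : V} (hv : v ∈ pgSideHalfS G φ s o nS hS L ℓS R (σ₀ * e) (-(σ₀ * f)) m) :
    A * (|vβ| * nS - |vα| * (|hS| + 1)) ≤ σ₀ * (A * (vβ * (φ v 0 - φ tc 0) - vα * (φ v 1 - φ tc 1))) := by
  obtain ⟨-, -, hα, hτ⟩ := (mem_pgSideHalfS G φ).1 hv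
  rw [relCoordO_eq_of_base htc, relCoord_apply] at hα
  rw [shearCoordO_eq_of_base htc] at hτ
  have hnS0 : (0 : ℤ) < nS := by exact_mod_cast hnS
  -- `n_s Δβ = β′ + h_s Δα`
  have eβ : (nS : ℤ) * (φ v 1 - φ tc 1) = shearCoord φ tc nS hS v + hS * (φ v 0 - φ tc 0) := by
    simp only [shearCoord_apply]; ring
  -- the split half: `(−σ₀ f)·β′ ≥ (−σ₀ f)·m ≥ −|m| ≥ −n_s`
  have hτ' : -(nS : ℤ) ≤ -(σ₀ * f) * shearCoord φ tc nS hS v := by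
    have h1 : -(σ₀ * f) * m ≤ -(σ₀ * f) * shearCoord φ tc nS hS v := by linarith [hτ]
    have h2 : |-(σ₀ * f) * m| = |m| := by
      rw [abs_mul]; rcases hσ₀ with rfl | rfl <;> rcases hf with rfl | rfl <;> simp
    have h3 := (abs_le.1 (le_of_eq h2)).1
    linarith
  have key : (nS : ℤ) * (σ₀ * (vβ * (φ v 0 - φ tc 0) - vα * (φ v 1 - φ tc 1))) =
      |vβ| * nS * nS + |vα| * (-(σ₀ * f) * shearCoord φ tc nS hS v) - e * (vα * hS * nS) := by
    have e1 : (nS : ℤ) * (σ₀ * (vβ * (φ v 0 - φ tc 0) - vα * (φ v 1 - φ tc 1))) =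
        σ₀ * vβ * nS * (φ v 0 - φ tc 0) - σ₀ * vα * ((nS : ℤ) * (φ v 1 - φ tc 1)) := by ring
    rw [e1, eβ, hα, ← hev, ← hfv]
    rcases hσ₀ with rfl | rfl <;> rcases hf with rfl | rfl <;> ring
  have hva : 0 ≤ |vα| := abs_nonneg _
  have hτ'' : -(|vα| * nS) ≤ |vα| * (-(σ₀ * f) * shearCoord φ tc nS hS v) := by nlinarith
  have hh : e * (vα * hS * nS) ≤ |vα| * |hS| * nS := by
    have he' : |e| = 1 := by rcases he with rfl | rfl <;> simp
    have : |e * (vα * hS * nS)| ≤ |vα| * |hS| * nS := by rw [abs_mul, he', one_mul, abs_mul, abs_mul, Nat.abs_cast]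
    exact (abs_le.1 this).2
  have h0 : (|vβ| * nS - |vα| * (|hS| + 1)) * nS ≤ (nS : ℤ) * (σ₀ * (vβ * (φ v 0 - φ tc 0) - vα * (φ v 1 - φ tc 1))) := by
    rw [key]; nlinarith
  have h0' : |vβ| * nS - |vα| * (|hS| + 1) ≤ σ₀ * (vβ * (φ v 0 - φ tc 0) - vα * (φ v 1 - φ tc 1)) :=
    le_of_mul_le_mul_right (by linarith) hnS0
  calc A * (|vβ| * nS - |vα| * (|hS| + 1)) ≤ A * (σ₀ * (vβ * (φ v 0 - φ tc 0) - vα * (φ v 1 - φ tc 1))) :=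
        mul_le_mul_of_nonneg_left h0' hA.le
    _ = σ₀ * (A * (vβ * (φ v 0 - φ tc 0) - vα * (φ v 1 - φ tc 1))) := by ring

/-! ## §2 Raw-side exits (kit centre at `tc`) -/

namespace FinePrm

variable (pr : FinePrm) (φ) (t : V)

/-- **RAW-SIDE EXIT BY A SLID x SIDE HALF** (`b = 0`): for the raw side `(oth I, σ₀)` of a face-frame box and a kit centre `tc` with `φ tc = φ s + o`, every
vertex of `pgSideHalfS s o n_s h_s L ℓ_s R σ₀ τ m` satisfies `L(φ v) + A′ + climC ≤ L(φ tc)` once `A′ + 2D ≤ n_s·D`. [cite: MartineauTassion2017, §3.2] -/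
theorem exit_frame_raw_sideHalfS (I : Fin 2) (hc : 0 < pr.cOf I) (hA : pr.A ≠ 0) (hnz : pr.lvGen I 0 ≠ 0) (hD : 0 < pr.D)
    (hL : pr.cOf I * pr.L I ≤ pr.D) (Lo Hi : Site 2) (σ₀ : ℤˣ) {A' : ℤ} {nS : ℕ} (hexit : A' + 2 * pr.D ≤ (nS : ℤ) * pr.D)
    {s tc : V} {o : Site 2} (htc : φ tc = φ s + o) {hS : ℤ} {L ℓS R : ℕ} {τ m : ℤ} {v : V}
    (hv : v ∈ pgSideHalfS G φ s o nS hS L ℓS R (σ₀ : ℤ) τ m) :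
    (pr.sideFormsU_frame φ t I 0 hc hA hnz hD Lo Hi (oth I) σ₀).lin (φ v) + A' + pr.climC I 0 (oth I) ≤
      (pr.sideFormsU_frame φ t I 0 hc hA hnz hD Lo Hi (oth I) σ₀).lin (φ tc) := by
  have hC : pr.climC I 0 (oth I) = pr.D := by unfold climC; rw [if_neg (oth_ne I)]
  have hσ : (σ₀ : ℤ) = 1 ∨ (σ₀ : ℤ) = -1 := by rcases Int.units_eq_one_or σ₀ with h | h <;> simp [h]
  refine SideForm.exit_of_depth_gap _ (pr.sideFormsU_frame_isAffine φ t I 0 hc hA hnz hD hL Lo Hi (oth I) σ₀) hD.le (k := nS)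
    (by rw [hC]; linarith) (depth_gap_of_disp ?_)
  rw [pr.frame_sub_raw, disp_raw_sideHalfS htc hσ hv]

/-- **RAW-SIDE EXIT BY A SLID SIDE HALF OF THE TRANSPOSED RECORD** (`b = 1`): the side line of `pgSideHalfS G (trφ φ) s o …` is `Δβ = σ₀ n_s` in `φ`'s
coordinates (`trφ φ tc = trφ φ s + o`); hence for the raw side `(oth I, σ₀)` of a face frame with raw axis `1`: `L(φ v) + A′ + climC ≤ L(φ tc)` once
`A′ + 2D ≤ n_s·D`. [cite: MartineauTassion2017, §3.2] -/
theorem exit_frame_raw_sideHalfST (I : Fin 2) (hc : 0 < pr.cOf I) (hA : pr.A ≠ 0) (hnz : pr.lvGen I 1 ≠ 0) (hD : 0 < pr.D)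
    (hL : pr.cOf I * pr.L I ≤ pr.D) (Lo Hi : Site 2) (σ₀ : ℤˣ) {A' : ℤ} {nS : ℕ} (hexit : A' + 2 * pr.D ≤ (nS : ℤ) * pr.D)
    {s tc : V} {o : Site 2} (htc : trφ φ tc = trφ φ s + o) {hS : ℤ} {L ℓS R : ℕ} {τ m : ℤ} {v : V}
    (hv : v ∈ pgSideHalfS G (trφ φ) s o nS hS L ℓS R (σ₀ : ℤ) τ m) :
    (pr.sideFormsU_frame φ t I 1 hc hA hnz hD Lo Hi (oth I) σ₀).lin (φ v) + A' + pr.climC I 1 (oth I) ≤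
      (pr.sideFormsU_frame φ t I 1 hc hA hnz hD Lo Hi (oth I) σ₀).lin (φ tc) := by
  have hC : pr.climC I 1 (oth I) = pr.D := by unfold climC; rw [if_neg (oth_ne I)]
  have hσ : (σ₀ : ℤ) = 1 ∨ (σ₀ : ℤ) = -1 := by rcases Int.units_eq_one_or σ₀ with h | h <;> simp [h]
  have hdisp := disp_raw_sideHalfS (G := G) (φ := trφ φ) htc hσ hv
  have e1 : relCoord (trφ φ) tc 0 v = relCoord φ tc 1 v := by simp [relCoord_apply, trφ_apply]
  refine SideForm.exit_of_depth_gap _ (pr.sideFormsU_frame_isAffine φ t I 1 hc hA hnz hD hL Lo Hi (oth I) σ₀) hD.le (k := nS)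
    (by rw [hC]; linarith) (depth_gap_of_disp ?_)
  rw [pr.frame_sub_raw, ← e1, hdisp]

/-! ## §3 Level-side exits (favourable half; kit centre at `tc`) -/

/-- **LEVEL-SIDE EXIT, `I = 0`, BY A FAVOURABLE SLID x SIDE HALF** (`0 < A`, `e v_β = |v_β|`, `f v_α = |v_α|`, `|m| ≤ n_s`): every vertex of
`pgSideHalfS s o n_s h_s L ℓ_s R (σ₀e) (−σ₀f) m` satisfies `L(φ v) + A′ + climC ≤ L(φ tc)` (`φ tc = φ s + o`) once `A′ + climC 0 b 0 + D ≤ k·D` and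
`(k+1)·D ≤ c₀·A·(|v_β| n_s − |v_α| (|h_s| + 1))`. [cite: MartineauTassion2017, §3.2] -/
theorem exit_frame_lv_zero_sideHalfS (b : Fin 2) (hc : 0 < pr.cOf 0) (hA : pr.A ≠ 0) (hnz : pr.lvGen 0 b ≠ 0) (hD : 0 < pr.D)
    (hL : pr.cOf 0 * pr.L 0 ≤ pr.D) (Lo Hi : Site 2) (σ₀ : ℤˣ) (hA0 : 0 < pr.A) {e f : ℤ} (he : e = 1 ∨ e = -1) (hf : f = 1 ∨ f = -1)
    (hev : e * pr.vβ = |pr.vβ|) (hfv : f * pr.vα = |pr.vα|) {A' k : ℤ} (hexit : A' + pr.climC 0 b 0 + pr.D ≤ k * pr.D) {nS : ℕ} (hnS : 1 ≤ nS)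
    {hS m : ℤ} (hm : |m| ≤ nS) (hk : (k + 1) * pr.D ≤ pr.c₀ * (pr.A * (|pr.vβ| * nS - |pr.vα| * (|hS| + 1))))
    {s tc : V} {o : Site 2} (htc : φ tc = φ s + o) {L ℓS R : ℕ} {v : V}
    (hv : v ∈ pgSideHalfS G φ s o nS hS L ℓS R ((σ₀ : ℤ) * e) (-((σ₀ : ℤ) * f)) m) :
    (pr.sideFormsU_frame φ t 0 b hc hA hnz hD Lo Hi 0 σ₀).lin (φ v) + A' + pr.climC 0 b 0 ≤
      (pr.sideFormsU_frame φ t 0 b hc hA hnz hD Lo Hi 0 σ₀).lin (φ tc) := by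
  have hσ : (σ₀ : ℤ) = 1 ∨ (σ₀ : ℤ) = -1 := by rcases Int.units_eq_one_or σ₀ with h | h <;> simp [h]
  have hc₀ : 0 < pr.c₀ := by have := pr.cOf_zero; rw [this] at hc; exact hc
  refine SideForm.exit_of_depth_gap _ (pr.sideFormsU_frame_isAffine φ t 0 b hc hA hnz hD hL Lo Hi 0 σ₀) hD.le (k := k) hexit
    (depth_gap_of_disp ?_)
  rw [pr.frame_apply_lv_zero, pr.frame_apply_lv_zero]
  set lv := lam0 pr.A pr.vα pr.vβ (relφ φ t v) with hlv
  set lc := lam0 pr.A pr.vα pr.vβ (relφ φ t tc) with hlc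
  have hM : (k + 1) * pr.D ≤ (σ₀ : ℤ) * (pr.c₀ * (lv - lc)) := by
    rw [hlv, hlc, lam0_relφ_sub]
    have h0 := disp_lv_sideHalfS (G := G) htc hnS hσ he hf hm hA0 hev hfv hv
    have h2 := mul_le_mul_of_nonneg_left h0 hc₀.le
    calc (k + 1) * pr.D ≤ pr.c₀ * (pr.A * (|pr.vβ| * nS - |pr.vα| * (|hS| + 1))) := hk
      _ ≤ pr.c₀ * ((σ₀ : ℤ) * (pr.A * (pr.vβ * (φ v 0 - φ tc 0) - pr.vα * (φ v 1 - φ tc 1)))) := h2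
      _ = _ := by ring
  have hms := mul_sub pr.c₀ lv lc
  rcases hσ with h1 | h1
  · rw [h1, one_mul] at hM
    rw [h1, one_mul]
    exact le_coarse_sub_of_mul hD (by linarith)
  · rw [h1, neg_one_mul] at hM
    rw [h1, neg_one_mul, neg_sub]
    exact le_coarse_sub_of_mul hD (by linarith)

/-- **LEVEL-SIDE EXIT, `I = 1`, BY A FAVOURABLE SIDE HALF OF THE TRANSPOSED RECORD** (u-face frame, `0 < A`, `0 ≤ n`, `f·h = |h|`, `|m| ≤ n_s`):
every vertex of `pgSideHalfS G (trφ φ) s o n_s h_s L ℓ_s R σ₀ (−σ₀f) m` (side line `Δβ = σ₀ n_s`, favourable tangential half) satisfies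
`L(φ v) + A′ + climC ≤ L(φ tc)` (`trφ φ tc = trφ φ s + o`) once `A′ + climC 1 b 1 + D ≤ k·D` and `(k+1)·D ≤ c₁·A·(n·n_s − |h| (|h_s| + 1))` —
the transposed-record replacement of N1's y′ top-piece exit (no slant, no shear term). [cite: MartineauTassion2017, §3.2] -/
theorem exit_frame_lv_one_sideHalfT (b : Fin 2) (hc : 0 < pr.cOf 1) (hA : pr.A ≠ 0) (hnz : pr.lvGen 1 b ≠ 0) (hD : 0 < pr.D)
    (hL : pr.cOf 1 * pr.L 1 ≤ pr.D) (Lo Hi : Site 2) (σ₀ : ℤˣ) (hA0 : 0 < pr.A) (hn : 0 ≤ pr.n) {f : ℤ} (hf : f = 1 ∨ f = -1)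
    (hfh : f * pr.h = |pr.h|) {A' k : ℤ} (hexit : A' + pr.climC 1 b 1 + pr.D ≤ k * pr.D) {nS : ℕ} (hnS : 1 ≤ nS)
    {hS m : ℤ} (hm : |m| ≤ nS) (hk : (k + 1) * pr.D ≤ pr.c₁ * (pr.A * (pr.n * nS - |pr.h| * (|hS| + 1))))
    {s tc : V} {o : Site 2} (htc : trφ φ tc = trφ φ s + o) {L ℓS R : ℕ} {v : V}
    (hv : v ∈ pgSideHalfS G (trφ φ) s o nS hS L ℓS R ((σ₀ : ℤ) * 1) (-((σ₀ : ℤ) * f)) m) :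
    (pr.sideFormsU_frame φ t 1 b hc hA hnz hD Lo Hi 1 σ₀).lin (φ v) + A' + pr.climC 1 b 1 ≤
      (pr.sideFormsU_frame φ t 1 b hc hA hnz hD Lo Hi 1 σ₀).lin (φ tc) := by
  have hσ : (σ₀ : ℤ) = 1 ∨ (σ₀ : ℤ) = -1 := by rcases Int.units_eq_one_or σ₀ with h | h <;> simp [h]
  have hc₁ : 0 < pr.c₁ := by have := pr.cOf_one; rw [this] at hc; exact hc
  have hen : (1 : ℤ) * pr.n = |pr.n| := by rw [one_mul, abs_of_nonneg hn]
  -- the level displacement of the transposed half, with (v_α, v_β) := (h, n) on `trφ φ`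
  have h0 := disp_lv_sideHalfS (G := G) (φ := trφ φ) htc hnS hσ (Or.inl rfl) hf hm hA0 hen hfh hv
  have et : ∀ w : V, trφ φ w 0 = φ w 1 ∧ trφ φ w 1 = φ w 0 := fun w => ⟨rfl, rfl⟩
  simp only [(et v).1, (et v).2, (et tc).1, (et tc).2, abs_of_nonneg hn] at h0
  refine SideForm.exit_of_depth_gap _ (pr.sideFormsU_frame_isAffine φ t 1 b hc hA hnz hD hL Lo Hi 1 σ₀) hD.le (k := k) hexit
    (depth_gap_of_disp ?_)
  rw [pr.frame_apply_lv_one, pr.frame_apply_lv_one]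
  set lv := lam1 pr.A pr.n pr.h (relφ φ t v) with hlv
  set lc := lam1 pr.A pr.n pr.h (relφ φ t tc) with hlc
  have hM : (k + 1) * pr.D ≤ (σ₀ : ℤ) * (pr.c₁ * (lv - lc)) := by
    rw [hlv, hlc, lam1_relφ_sub]
    have h2 := mul_le_mul_of_nonneg_left h0 hc₁.le
    calc (k + 1) * pr.D ≤ pr.c₁ * (pr.A * (pr.n * nS - |pr.h| * (|hS| + 1))) := hk
      _ ≤ pr.c₁ * ((σ₀ : ℤ) * (pr.A * (pr.n * (φ v 1 - φ tc 1) - pr.h * (φ v 0 - φ tc 0)))) := h2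
      _ = _ := by ring
  have hms := mul_sub pr.c₁ lv lc
  rcases hσ with h1 | h1
  · rw [h1, one_mul] at hM
    rw [h1, one_mul]
    exact le_coarse_sub_of_mul hD (by linarith)
  · rw [h1, neg_one_mul] at hM
    rw [h1, neg_one_mul, neg_sub]
    exact le_coarse_sub_of_mul hD (by linarith)

end FinePrm

end Skelφ

end Summit.CriticalPhenomena.PercolationContinuityZ3.Theorems.Transplant

end
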